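import Literature.NumberTheory.Transcendental.PreBlochRogersProofs
import HarnessLib

/-!
# Rigidity of the root symbols along rational curves (towards Dupont Thm. 8.16 / Suslin Thm. 6.3)

Sixth step towards the named fact
`Literature.NumberTheory.Transcendental.Suslin1991_preBloch_isUniquelyDivisible`
(`PreBlochGroup.lean`; Dupont, *Scissors congruences, group homology and characteristic classes*
(2001), **Thm. 8.16**: `𝒫_F` is uniquely divisible for `F` algebraically closed of characteristic
`0`). What is still missing after `PreBlochUniqueDivisibility.lean` is the injectivity of
`p • (·)` on `P(F)` for odd primes `p`, which Dupont defers to Suslin: one must show that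
`{w}/n := ∑_{j<n} {ζʲ w^{1/n}}` respects the five-term relation. Suslin (*Algebraic `K`-theory of
fields*, Proc. ICM Berkeley 1986, Thm. 6.3, pp. 237–238) writes the relation to be checked as
(`u, v, w ∉ μ_p ∪ 0`, `w^p = (1 - u^p)/(1 - v^p)`)

  `Ψ(u, v, w) = ∑_ξ [ξu] - ∑_ξ [ξv] + ∑_ξ [ξ v/u] - ∑_ξ [ξ wv/u] + ∑_ξ [ξw] = 0`,

notes that "this element lies in `ₚB(F)`", realises it as a specialization of a universal element
over the function field of the curve `(1 - v^p) w^p = 1 - u^p` (`w` fixed), and concludes by his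
Prop. 6.2: the specializations of an `n`-torsion element of `B(F(C))` at any two points of a smooth
connected curve `C` agree (proved with the transfer on `B`, which is defined through `K₃`).

**What is proved here** is the part of this rigidity that Rogers' identity (Dupont Thm. 8.14 =
`PreBloch.rogers`) gives without any `K`-theory, namely rigidity along RATIONAL curves on the
surfaces `S_n : (1 - vⁿ) wⁿ = 1 - uⁿ`, for every `n ≥ 1`:

* `sum_rogersL_root_mul`: `∑_{j<n} L(ζʲ x) = x⁻ * (1 - xⁿ)` (the mechanism behind Dupont Cor. 8.15);
* `five_packet_pairing_eq_zero`: for `u, v, w ∈ F(t)ˣ` on `S_n` the five pairings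
  `xᵢ⁻ * (1 - xᵢⁿ)` (`x = (u, v, v/u, wv/u, w)`, signs `+ - + - +`) sum to
  `u⁻ * wⁿ + w⁻ * uⁿ = n (u⁻ * w + w⁻ * u) = 0` — pure bilinearity and antisymmetry of the pairing;
* **`root_packets_rigidity`**: consequently `Ψ̃` (the displayed sum with Dupont's extended symbols
  at a place) takes the same value at the places `t = 0` and `t = ∞` of `F(t)` for every rational
  curve `(u(t), v(t), w(t))` on `S_n` — Suslin's Prop. 6.2 for `C = P¹`, here even without the
  torsion hypothesis;
* `regInf_evInf_div`: the value at `t = ∞` of a quotient of polynomials of degree `≤ N` / `= N`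
  (bookkeeping used by the applications).

For `n = 3` the surface `S₃` is a (rational) cubic surface and this rigidity yields the five-term
relation for `{w}/3` and the absence of `3`-torsion (`PreBlochThird.lean`); for `n ≥ 5`, `S_n` is
a Fermat surface of general type, not covered by rational curves, and Suslin's transfer argument is
needed — it is NOT formalized here.

## References

* J. L. Dupont, *Scissors congruences, group homology and characteristic classes*, World
  Scientific 2001: Thm. 8.14, Cor. 8.15, Thm. 8.16 and p. 43. [Dupont2001]
* A. A. Suslin, *Algebraic K-theory of fields*, Proc. ICM Berkeley 1986, vol. 1, 222–244: §6,
  Prop. 6.2, Thm. 6.3. [Suslin1986]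
* J. L. Dupont, C.-H. Sah, *Scissors congruences II*, J. Pure Appl. Algebra 25 (1982): (5.13),
  Thm. 5.14. [DupontSah1982]
-/

noncomputable section

namespace Literature.NumberTheory.Transcendental

namespace PreBloch

variable {F : Type*} [Field F]

open Polynomial

/-! ### The place `t = ∞` on quotients of polynomials -/

/-- `p(t⁻¹) = (reflect N p)(t) / t^N` in `F(t)` when `deg p ≤ N`. [folklore] -/
theorem aeval_inv_X_eq_div (N : ℕ) {p : F[X]} (hp : p.natDegree ≤ N) :
    Polynomial.aeval ((RatFunc.X : RatFunc F)⁻¹) p =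
      algebraMap F[X] (RatFunc F) (reflect N p) / RatFunc.X ^ N := by
  haveI : Invertible (RatFunc.X : RatFunc F) := invertibleOfNonzero RatFunc.X_ne_zero
  have hr : (reflect N p).natDegree ≤ N := by
    refine le_trans natDegree_reflect_le ?_
    exact max_le le_rfl hp
  have h := Polynomial.eval₂_reflect_mul_pow (algebraMap F (RatFunc F)) (RatFunc.X : RatFunc F) N
    (reflect N p) hr
  rw [reflect_reflect, invOf_eq_inv] at h
  rw [eq_div_iff (pow_ne_zero N RatFunc.X_ne_zero), Polynomial.aeval_def, h, ← Polynomial.aeval_def,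
    RatFunc.aeval_X_left_eq_algebraMap]

/-- **The value at `t = ∞` of a quotient of polynomials**: if `deg p ≤ N = deg q` then `p/q` is
regular at `∞` with value `p_N / q_N` (ratio of the coefficients of `t^N`). [folklore] -/
theorem regInf_evInf_div {N : ℕ} {p q : F[X]} (hp : p.natDegree ≤ N) (hq : q.natDegree ≤ N)
    (hqN : q.coeff N ≠ 0) :
    regInf (algebraMap F[X] (RatFunc F) p / algebraMap F[X] (RatFunc F) q) ∧
      evInf (algebraMap F[X] (RatFunc F) p / algebraMap F[X] (RatFunc F) q) =
        p.coeff N / q.coeff N := by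
  have hXN : (RatFunc.X : RatFunc F) ^ N ≠ 0 := pow_ne_zero N RatFunc.X_ne_zero
  have hrq : (reflect N q).eval 0 ≠ 0 := by
    rwa [← coeff_zero_eq_eval_zero, coeff_reflect, revAt_zero]
  have hrq0 : algebraMap F[X] (RatFunc F) (reflect N q) ≠ 0 := by
    refine RatFunc.algebraMap_ne_zero fun h => hrq ?_
    rw [h, eval_zero]
  have e : invT (algebraMap F[X] (RatFunc F) p / algebraMap F[X] (RatFunc F) q) =
      algebraMap F[X] (RatFunc F) (reflect N p) / algebraMap F[X] (RatFunc F) (reflect N q) := by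
    rw [invT_div, aeval_inv_X_eq_div N hp, aeval_inv_X_eq_div N hq,
      div_div_div_cancel_right₀ hXN]
  obtain ⟨hr, hv⟩ := reg0_div (F := F) (p := reflect N p) (q := reflect N q) hrq
  refine ⟨?_, ?_⟩
  · show reg0 _
    rwa [e]
  · show ev0 _ = _
    rw [e, hv, ← coeff_zero_eq_eval_zero, ← coeff_zero_eq_eval_zero, coeff_reflect, coeff_reflect,
      revAt_zero]

/-- Constants are regular at `t = 0` with their value. [folklore] -/
theorem reg0_ev0_C (c : F) : reg0 (RatFunc.C c) ∧ ev0 (RatFunc.C c) = c := by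
  rw [← RatFunc.algebraMap_C]
  exact ⟨reg0_algebraMap _, by rw [ev0_algebraMap, eval_C]⟩

/-- Constants are regular at `t = ∞` with their value. [folklore] -/
theorem regInf_evInf_C (c : F) : regInf (RatFunc.C c) ∧ evInf (RatFunc.C c) = c := by
  show reg0 (invT (RatFunc.C c)) ∧ ev0 (invT (RatFunc.C c)) = c
  rw [invT_C]
  exact reg0_ev0_C c

/-- The symbol at a place of `c · f` for `f` regular: `⟦c · f(place)⟧`. [folklore] -/
theorem placeSym_C_mul {Reg : RatFunc F → Prop} {ev : RatFunc F → F} (hP : IsPlace (RatFunc F) F Reg ev)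
    {c : F} (hc : Reg (RatFunc.C c) ∧ ev (RatFunc.C c) = c) {f : RatFunc F} (hf : Reg f) :
    placeSym Reg ev (RatFunc.C c * f) = sym (c * ev f) := by
  rw [placeSym_of_reg (hP.reg_mul hc.1 hf), hP.ev_mul hc.1 hf, hc.2]

/-! ### Packets of Rogers' `L` over the `n`-th roots of unity -/

/-- `∏_{j<n} (1 - ζʲ x) = 1 - xⁿ` in `F(t)` for a primitive `n`-th root of unity `ζ ∈ F`
(the factorisation `Xⁿ - xⁿ = ∏ (X - ζʲ x)` evaluated at `X = 1`). [folklore] -/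
theorem prod_one_sub_root_mul {n : ℕ} (hn : 0 < n) {ζ : F} (hζ : IsPrimitiveRoot ζ n)
    (x : RatFunc F) : ∏ j ∈ Finset.range n, (1 - RatFunc.C (ζ ^ j) * x) = 1 - x ^ n := by
  have hζ' : IsPrimitiveRoot (RatFunc.C ζ : RatFunc F) n := hζ.map_of_injective RatFunc.C_injective
  have h := X_pow_sub_C_eq_prod hζ' hn (rfl : x ^ n = x ^ n)
  have h1 := congrArg (Polynomial.eval (1 : RatFunc F)) h
  rw [eval_sub, eval_pow, eval_X, eval_C, one_pow, eval_prod] at h1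
  rw [h1]
  refine Finset.prod_congr rfl fun j _ => ?_
  rw [eval_sub, eval_X, eval_C, map_pow]

/-- Each factor `1 - ζʲ x` is non-zero as soon as `xⁿ ≠ 1`. [folklore] -/
theorem one_sub_root_mul_ne_zero {n : ℕ} (hn : 0 < n) {ζ : F} (hζ : IsPrimitiveRoot ζ n)
    {x : RatFunc F} (hx : x ^ n ≠ 1) {j : ℕ} (hj : j ∈ Finset.range n) :
    1 - RatFunc.C (ζ ^ j) * x ≠ 0 := by
  intro h
  apply hx
  have hp := prod_one_sub_root_mul hn hζ x
  rw [Finset.prod_eq_zero hj h] at hp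
  exact (sub_eq_zero.1 hp.symm).symm

/-- `(f/f')⁻ * g = f⁻ * g - f'⁻ * g`. [cite: DupontSah1982, (5.13)] -/
theorem pairing_div_left {f f' : RatFunc F} (hf : f ≠ 0) (hf' : f' ≠ 0) (g : RatFunc F) :
    pairing (f / f') g = pairing f g - pairing f' g := by
  rw [div_eq_mul_inv, pairing_mul_left hf (inv_ne_zero hf'), pairing_inv_left, sub_eq_add_neg]

/-- `f⁻ * (g/g') = f⁻ * g - f⁻ * g'`. [cite: DupontSah1982, (5.13)] -/
theorem pairing_div_right {g g' : RatFunc F} (hg : g ≠ 0) (hg' : g' ≠ 0) (f : RatFunc F) :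
    pairing f (g / g') = pairing f g - pairing f g' := by
  rw [div_eq_mul_inv, pairing_mul_right hg (inv_ne_zero hg'), pairing_inv_right, sub_eq_add_neg]

/-- The pairing with a power: `f⁻ * gⁿ = n (f⁻ * g)`. [cite: DupontSah1982, (5.13)] -/
theorem pairing_pow_right {g : RatFunc F} (hg : g ≠ 0) (f : RatFunc F) (n : ℕ) :
    pairing f (g ^ n) = n • pairing f g := by
  have h := pairing_prod_right (Finset.range n) (u := fun _ => g) (fun _ _ => hg) f
  rwa [Finset.prod_const, Finset.card_range, Finset.sum_const, Finset.card_range] at h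

/-- The pairing with a power: `(fⁿ)⁻ * g = n (f⁻ * g)`. [cite: DupontSah1982, (5.13)] -/
theorem pairing_pow_left {f : RatFunc F} (hf : f ≠ 0) (g : RatFunc F) (n : ℕ) :
    pairing (f ^ n) g = n • pairing f g := by
  have h := pairing_prod_left (Finset.range n) (u := fun _ => f) (fun _ _ => hf) g
  rwa [Finset.prod_const, Finset.card_range, Finset.sum_const, Finset.card_range] at h

/-- **A packet of Rogers' `L` over the `n`-th roots of unity**:
`∑_{j<n} L(ζʲ x) = ∑_j x⁻ * (1 - ζʲ x) = x⁻ * (1 - xⁿ)` (constants pair to zero). This is the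
computation behind Dupont's Cor. 8.15. [cite: Dupont2001, Cor. 8.15] -/
theorem sum_rogersL_root_mul {n : ℕ} (hn : 0 < n) {ζ : F} (hζ : IsPrimitiveRoot ζ n)
    {x : RatFunc F} (hx : x ≠ 0) (hxn : x ^ n ≠ 1) :
    ∑ j ∈ Finset.range n, rogersL (RatFunc.C (ζ ^ j) * x) = pairing x (1 - x ^ n) := by
  have h1 : ∀ j ∈ Finset.range n, rogersL (RatFunc.C (ζ ^ j) * x) = pairing x (1 - RatFunc.C (ζ ^ j) * x) := by
    intro j _
    unfold rogersL
    rw [pairing_C_mul_left (pow_ne_zero j (hζ.ne_zero hn.ne')) hx]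
  rw [Finset.sum_congr rfl h1, ← pairing_prod_right (Finset.range n)
    (fun j hj => one_sub_root_mul_ne_zero hn hζ hxn hj) x, prod_one_sub_root_mul hn hζ x]

/-! ### The five packets on the surface `(1 - vⁿ) wⁿ = 1 - uⁿ` -/

/-- **The five packets pair to zero.** For `u, v, w ∈ F(t)ˣ` with `(1 - vⁿ) wⁿ = 1 - uⁿ`
(`uⁿ, vⁿ ≠ 1`, `uⁿ ≠ vⁿ`) and `x = (u, v, v/u, wv/u, w)`:
`∑ᵢ ± xᵢ⁻ * (1 - xᵢⁿ) = u⁻ * wⁿ + w⁻ * uⁿ = n (u⁻ * w + w⁻ * u) = 0` (with `B = 1 - vⁿ`,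
`E = uⁿ - vⁿ`: `1 - uⁿ = B wⁿ`, `1 - (v/u)ⁿ = E/uⁿ`, `1 - (wv/u)ⁿ = E/(B uⁿ)`, `1 - wⁿ = E/B`, and the
pairing is bilinear, kills constants and is antisymmetric over an algebraically closed field). This is
the divisor-level content of Suslin's remark that `Ψ` "lies in `ₚB(F)`". [cite: Suslin1986, Thm. 6.3] -/
theorem five_packet_pairing_eq_zero [IsAlgClosed F] {n : ℕ} {u v w : RatFunc F}
    (hu : u ≠ 0) (hv : v ≠ 0) (hw : w ≠ 0) (hvn : v ^ n ≠ 1)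
    (huv : u ^ n ≠ v ^ n) (hS : (1 - v ^ n) * w ^ n = 1 - u ^ n) :
    pairing u (1 - u ^ n) - pairing v (1 - v ^ n) + pairing (v / u) (1 - (v / u) ^ n) -
      pairing (w * v / u) (1 - (w * v / u) ^ n) + pairing w (1 - w ^ n) = 0 := by
  -- the atoms `B = 1 - vⁿ`, `E = uⁿ - vⁿ`, `U = uⁿ`
  have hB : (1 : RatFunc F) - v ^ n ≠ 0 := sub_ne_zero.2 (Ne.symm hvn)
  have hE : u ^ n - v ^ n ≠ (0 : RatFunc F) := sub_ne_zero.2 huv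
  have hU : u ^ n ≠ 0 := pow_ne_zero n hu
  have hW : w ^ n ≠ 0 := pow_ne_zero n hw
  have hwn : w ^ n = (1 - u ^ n) / (1 - v ^ n) := by
    rw [eq_div_iff hB, mul_comm, hS]
  -- the composite second arguments
  have e3 : 1 - (v / u) ^ n = (u ^ n - v ^ n) / u ^ n := by
    rw [div_pow, eq_div_iff hU, sub_mul, div_mul_cancel₀ _ hU, one_mul]
  have e4 : 1 - (w * v / u) ^ n = (u ^ n - v ^ n) / ((1 - v ^ n) * u ^ n) := by
    rw [div_pow, mul_pow, hwn, eq_div_iff (mul_ne_zero hB hU)]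
    field_simp
    ring
  have e5 : 1 - w ^ n = (u ^ n - v ^ n) / (1 - v ^ n) := by
    rw [hwn, eq_div_iff hB]
    field_simp
    ring
  -- expand by bilinearity
  have x1 : pairing u (1 - u ^ n) = pairing u (1 - v ^ n) + n • pairing u w := by
    rw [← hS, pairing_mul_right hB hW, pairing_pow_right hw]
  have x3 : pairing (v / u) (1 - (v / u) ^ n) =
      pairing v (u ^ n - v ^ n) - n • pairing v u - pairing u (u ^ n - v ^ n) := by
    rw [e3, pairing_div_left hv hu, pairing_div_right hE hU, pairing_div_right hE hU,
      pairing_pow_right hu, pairing_pow_right hu, pairing_self, smul_zero, sub_zero]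
  have x4 : pairing (w * v / u) (1 - (w * v / u) ^ n) =
      (pairing w (u ^ n - v ^ n) - pairing w (1 - v ^ n) + n • pairing u w) +
      (pairing v (u ^ n - v ^ n) - pairing v (1 - v ^ n) - n • pairing v u) -
      (pairing u (u ^ n - v ^ n) - pairing u (1 - v ^ n)) := by
    rw [e4, pairing_div_left (mul_ne_zero hw hv) hu, pairing_mul_left hw hv,
      pairing_div_right hE (mul_ne_zero hB hU), pairing_div_right hE (mul_ne_zero hB hU),
      pairing_div_right hE (mul_ne_zero hB hU), pairing_mul_right hB hU, pairing_mul_right hB hU,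
      pairing_mul_right hB hU, pairing_pow_right hu, pairing_pow_right hu, pairing_pow_right hu,
      pairing_self, pairing_symm u w, smul_zero, smul_neg]
    abel
  have x5 : pairing w (1 - w ^ n) = pairing w (u ^ n - v ^ n) - pairing w (1 - v ^ n) := by
    rw [e5, pairing_div_right hE hB]
  rw [x1, x3, x4, x5]
  abel

/-- **Rigidity of the root packets along a rational curve on `S_n`.** For `F` algebraically closed,
`ζ` a primitive `n`-th root of unity and `u, v, w ∈ F(t)ˣ` with `(1 - vⁿ) wⁿ = 1 - uⁿ`
(`uⁿ, vⁿ ≠ 1`, `uⁿ ≠ vⁿ`), Suslin's sum of extended symbols at a place `π`,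
`Ψ̃_π = ∑_{j<n} (⟦ζʲu⟧_π - ⟦ζʲv⟧_π + ⟦ζʲ v/u⟧_π - ⟦ζʲ wv/u⟧_π + ⟦ζʲ w⟧_π)`,
takes the same value at `π = (t = 0)` and at `π = (t = ∞)`: by Rogers' identity
`L(f) = ⟦f(0)⟧ - ⟦f(∞)⟧` summed over the packets and `five_packet_pairing_eq_zero`. This is the
case `C = P¹` of Suslin's Prop. 6.2 (there for `n`-torsion elements of `B(F(C))` and arbitrary
smooth curves `C`, via the `K₃`-transfer), obtained here from Dupont's Thm. 8.14 alone.
[cite: Suslin1986, Prop. 6.2] -/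
theorem root_packets_rigidity [IsAlgClosed F] {n : ℕ} (hn : 0 < n) {ζ : F} (hζ : IsPrimitiveRoot ζ n)
    {u v w : RatFunc F} (hu : u ≠ 0) (hv : v ≠ 0) (hw : w ≠ 0) (hun : u ^ n ≠ 1) (hvn : v ^ n ≠ 1)
    (huv : u ^ n ≠ v ^ n) (hS : (1 - v ^ n) * w ^ n = 1 - u ^ n) :
    ∑ j ∈ Finset.range n, (placeSym reg0 ev0 (RatFunc.C (ζ ^ j) * u) -
        placeSym reg0 ev0 (RatFunc.C (ζ ^ j) * v) + placeSym reg0 ev0 (RatFunc.C (ζ ^ j) * (v / u)) -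
        placeSym reg0 ev0 (RatFunc.C (ζ ^ j) * (w * v / u)) + placeSym reg0 ev0 (RatFunc.C (ζ ^ j) * w)) =
    ∑ j ∈ Finset.range n, (placeSym regInf evInf (RatFunc.C (ζ ^ j) * u) -
        placeSym regInf evInf (RatFunc.C (ζ ^ j) * v) + placeSym regInf evInf (RatFunc.C (ζ ^ j) * (v / u)) -
        placeSym regInf evInf (RatFunc.C (ζ ^ j) * (w * v / u)) + placeSym regInf evInf (RatFunc.C (ζ ^ j) * w)) := by
  have hU : u ^ n ≠ 0 := pow_ne_zero n hu
  have hB : (1 : RatFunc F) - v ^ n ≠ 0 := sub_ne_zero.2 (Ne.symm hvn)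
  have hE : u ^ n - v ^ n ≠ (0 : RatFunc F) := sub_ne_zero.2 huv
  have hwn : w ^ n = (1 - u ^ n) / (1 - v ^ n) := by
    rw [eq_div_iff hB, mul_comm, hS]
  -- non-degeneracy of the three composite functions
  have h3 : (v / u) ^ n ≠ 1 := by
    rw [div_pow, Ne, div_eq_one_iff_eq hU]
    exact Ne.symm huv
  have h4 : (w * v / u) ^ n ≠ 1 := by
    intro h
    rw [div_pow, mul_pow, div_eq_one_iff_eq hU, hwn, div_mul_eq_mul_div, div_eq_iff hB] at h
    apply hE
    linear_combination -h
  have h5 : w ^ n ≠ 1 := by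
    rw [hwn, Ne, div_eq_one_iff_eq hB]
    intro h
    apply hE
    linear_combination -h
  -- Rogers' identity packet by packet
  have key : ∀ {x : RatFunc F}, x ≠ 0 → x ^ n ≠ 1 →
      ∑ j ∈ Finset.range n, (placeSym reg0 ev0 (RatFunc.C (ζ ^ j) * x) -
        placeSym regInf evInf (RatFunc.C (ζ ^ j) * x)) = pairing x (1 - x ^ n) := by
    intro x hx hxn
    rw [← sum_rogersL_root_mul hn hζ hx hxn]
    refine Finset.sum_congr rfl fun j _ => ?_
    rw [rogers]
    rfl
  have k1 := key hu hun
  have k2 := key hv hvn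
  have k3 := key (div_ne_zero hv hu) h3
  have k4 := key (div_ne_zero (mul_ne_zero hw hv) hu) h4
  have k5 := key hw h5
  have tot := five_packet_pairing_eq_zero hu hv hw hvn huv hS
  rw [← k1, ← k2, ← k3, ← k4, ← k5] at tot
  rw [← Finset.sum_sub_distrib, ← Finset.sum_add_distrib, ← Finset.sum_sub_distrib,
    ← Finset.sum_add_distrib] at tot
  rw [← sub_eq_zero, ← Finset.sum_sub_distrib, ← tot]
  exact Finset.sum_congr rfl fun j _ => by abel

end PreBloch

end Literature.NumberTheory.Transcendental
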